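import Summits.QuantumFields.BalabanUV.Beta.TubeMaximumModulus

/-!
# Beta / WindingIncrement — continuous logarithms along a real interval, their increments, and THE CERTIFICATE INTERFACE
# «winding by compass words» (β sub-cell, BINDER-OWNERS row CAP-k, lineage `b2b-balaban-beta-an5`, gen 23; node
# BETA-an5-g23-THEOREM-DB, leaf 1 of 3; journal CLAIM l.14161)

THE PROBLEM.  Route A's rows (`CapRouteA.rowsOfOneLoopFormCode16E_routeA₂`, `TubeHolAlgebra.tubeHol_oneLoopForm`, …) carry the
(Z1) binder `hdet : ∀ p ∈ Strip (d+1) a, (A p).det ≠ 0` — zero-freeness of a tube-holomorphic multiplier on the whole `2(d+1)`-real-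
dimensional period cell.  CAP-KERNEL §4.8 (xi) THEOREM DB (cap3, prose; cross-read cap-ref #8 §46) reduces it to (F) zero-freeness on
the distinguished boundary plus (W) finitely many ONE-dimensional winding-number certificates, by the iterated argument principle.
This leaf supplies the one-dimensional currency of (W) in the kernel; leaf 2 (`StripArgumentPrinciple`) is the one-variable
argument principle on a period strip; leaf 3 (`TubeZeroFree`) is THEOREM DB itself with the END `hdet` BY NAME.

* §1 `IsContLog φ s t L`: `L` is a continuous logarithm of `φ : ℝ → ℂ` on `[s, t]` (`exp (L x) = φ x`).  Restriction, products,
  congruence; the ε-CHAIN LEMMA `chain_Icc` on a compact interval (the engine of every «locally constant ⟹ constant» step of the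
  node); UNIQUENESS `IsContLog.incr_eq`: two continuous logarithms have the same increment `L t − L s` (they differ by a constant in
  `2πiℤ`); EXISTENCE `exists_isContLog` for every continuous non-vanishing `φ` (Heine–Cantor + chaining with the principal logarithm
  of `φ/φ(x_j)` in the disc `|w − 1| < 1`).
* §2 THE RATIO LEMMA `IsContLog.of_near` ∕ `incr_eq_of_near` (Rouché on a line): `‖ψ − φ‖ < ‖φ‖` pointwise ⟹ `L + log (ψ/φ)` is a
  logarithm of `ψ`; if `ψ/φ` takes the same value at both ends the increments of `ψ` and `φ` agree.  §2b PERIODIC WINDOWS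
  `incr_eq_of_periodic`: for a `T`-periodic non-vanishing continuous `φ` the increment over `[s, s + T]` does not depend on `s`.
* The CERTIFICATE INTERFACE «winding by compass words» (what a (W) certificate must deliver: sign conditions on validated
  enclosures of `φ` along a partition of the period ⟹ the increment in closed form, `2πk·I` for a closed word) is the companion
  leaf `Beta.WindingWords`.

HONEST FRAMING.  Kernel glue ([folklore] one-variable analysis over Mathlib); no number of the β-function, no binder instance, no
certificate for the cell's `k₀`.  Discharging `BetaPertH` would make Bałaban's ultraviolet stability unconditional — NOT the
continuum limit, NOT the Clay problem.  0 `sorry`, 0 cite tags.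
-/

namespace Summit.QuantumFields.BalabanUV.Beta.WindingIncrement

open Complex Set Metric
open scoped Real

noncomputable section

/-! ## §1 Continuous logarithms along a real interval -/

/-- `L` is a CONTINUOUS LOGARITHM of `φ` on the interval `[s, t]`: continuous there with `exp (L x) = φ x`. [folklore] -/
structure IsContLog (φ : ℝ → ℂ) (s t : ℝ) (L : ℝ → ℂ) : Prop where
  cont : ContinuousOn L (Icc s t)
  exp_eq : ∀ x ∈ Icc s t, exp (L x) = φ x

namespace IsContLog

variable {φ ψ : ℝ → ℂ} {s t : ℝ} {L M : ℝ → ℂ}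

/-- a function with a continuous logarithm does not vanish. [folklore] -/
theorem ne_zero (h : IsContLog φ s t L) {x : ℝ} (hx : x ∈ Icc s t) : φ x ≠ 0 := by
  rw [← h.exp_eq x hx]; exact exp_ne_zero _

/-- a function with a continuous logarithm is continuous. [folklore] -/
theorem continuousOn (h : IsContLog φ s t L) : ContinuousOn φ (Icc s t) :=
  h.cont.cexp.congr fun x hx => (h.exp_eq x hx).symm

/-- restriction to a sub-interval. [folklore] -/
theorem mono (h : IsContLog φ s t L) {s' t' : ℝ} (hs : s ≤ s') (ht : t' ≤ t) : IsContLog φ s' t' L where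
  cont := h.cont.mono (Icc_subset_Icc hs ht)
  exp_eq x hx := h.exp_eq x (Icc_subset_Icc hs ht hx)

/-- a continuous logarithm of `φ` is one of every function agreeing with `φ` on the interval. [folklore] -/
theorem congr (h : IsContLog φ s t L) (hψ : ∀ x ∈ Icc s t, ψ x = φ x) : IsContLog ψ s t L where
  cont := h.cont
  exp_eq x hx := by rw [hψ x hx]; exact h.exp_eq x hx

/-- changing the logarithm on the interval to an equal function. [folklore] -/
theorem congr_log (h : IsContLog φ s t L) (hM : ∀ x ∈ Icc s t, M x = L x) : IsContLog φ s t M where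
  cont := h.cont.congr hM
  exp_eq x hx := by rw [hM x hx]; exact h.exp_eq x hx

/-- PRODUCTS: logarithms add. [folklore] -/
theorem mul (h : IsContLog φ s t L) (h' : IsContLog ψ s t M) :
    IsContLog (fun x => φ x * ψ x) s t (fun x => L x + M x) where
  cont := h.cont.add h'.cont
  exp_eq x hx := by rw [exp_add, h.exp_eq x hx, h'.exp_eq x hx]

/-- INTEGER POWERS: `n • L` is a logarithm of `φ ^ n`. [folklore] -/
theorem zpow (h : IsContLog φ s t L) (n : ℤ) : IsContLog (fun x => φ x ^ n) s t (fun x => n * L x) where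
  cont := continuousOn_const.mul h.cont
  exp_eq x hx := by rw [exp_int_mul, h.exp_eq x hx]

/-- FINITE PRODUCTS: logarithms add over a `Finset`. [folklore] -/
theorem prod {ι : Type*} (S : Finset ι) {Φ : ι → ℝ → ℂ} {Λ : ι → ℝ → ℂ} (h : ∀ i ∈ S, IsContLog (Φ i) s t (Λ i)) :
    IsContLog (fun x => ∏ i ∈ S, Φ i x) s t (fun x => ∑ i ∈ S, Λ i x) := by
  classical
  induction S using Finset.induction_on with
  | empty => exact ⟨continuousOn_const, fun x _ => by simp⟩
  | insert a S ha ih =>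
    have h' := (h a (Finset.mem_insert_self a S)).mul (ih fun i hi => h i (Finset.mem_insert_of_mem hi))
    refine ⟨h'.cont.congr fun x _ => ?_, fun x hx => ?_⟩
    · rw [Finset.sum_insert ha]
    · rw [Finset.sum_insert ha, Finset.prod_insert ha]; exact h'.exp_eq x hx

/-- shifting a logarithm by a constant in `2πiℤ`. [folklore] -/
theorem add_int_mul (h : IsContLog φ s t L) (n : ℤ) : IsContLog φ s t (fun x => L x + n * (2 * π * I)) where
  cont := h.cont.add continuousOn_const
  exp_eq x hx := by rw [exp_add, h.exp_eq x hx, exp_int_mul_two_pi_mul_I, mul_one]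

/-- shifting a logarithm by a constant `c` with `exp c = 1`. [folklore] -/
theorem add_const_of_exp_eq_one (h : IsContLog φ s t L) {c : ℂ} (hc : exp c = 1) :
    IsContLog φ s t (fun x => L x + c) where
  cont := h.cont.add continuousOn_const
  exp_eq x hx := by rw [exp_add, h.exp_eq x hx, hc, mul_one]

/-- constants: the principal logarithm. [folklore] -/
theorem const {c : ℂ} (hc : c ≠ 0) (s t : ℝ) : IsContLog (fun _ => c) s t (fun _ => log c) where
  cont := continuousOn_const
  exp_eq _ _ := exp_log hc

/-- a continuous function with values in the SLIT PLANE has the principal logarithm as a continuous logarithm. [folklore] -/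
theorem of_mem_slitPlane (hφ : ContinuousOn φ (Icc s t)) (hsl : ∀ x ∈ Icc s t, φ x ∈ slitPlane) :
    IsContLog φ s t (fun x => log (φ x)) where
  cont := hφ.clog hsl
  exp_eq x hx := exp_log (slitPlane_ne_zero (hsl x hx))

/-- translating the variable: a logarithm of `x ↦ φ (x + c)` on `[s − c, t − c]`. [folklore] -/
theorem comp_add (h : IsContLog φ s t L) (c : ℝ) :
    IsContLog (fun x => φ (x + c)) (s - c) (t - c) (fun x => L (x + c)) where
  cont := by
    refine h.cont.comp (continuousOn_id.add continuousOn_const) fun x hx => ?_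
    exact ⟨by linarith [hx.1], by linarith [hx.2]⟩
  exp_eq x hx := h.exp_eq (x + c) ⟨by linarith [hx.1], by linarith [hx.2]⟩

/-- reversing the variable: a logarithm of `x ↦ φ (−x)` on `[−t, −s]`. [folklore] -/
theorem comp_neg (h : IsContLog φ s t L) : IsContLog (fun x => φ (-x)) (-t) (-s) (fun x => L (-x)) where
  cont := by
    refine h.cont.comp continuousOn_neg fun x hx => ?_
    exact ⟨by linarith [hx.2], by linarith [hx.1]⟩
  exp_eq x hx := h.exp_eq (-x) ⟨by linarith [hx.2], by linarith [hx.1]⟩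

end IsContLog

/-! ### The ε-chain lemma and the `2πiℤ` rigidity -/

/-- THE ε-CHAIN LEMMA on a compact interval: a property holding at `s` and propagating from any point of `[s, t]` to every
point of `[s, t]` within distance `δ` holds on all of `[s, t]` (walk from `s` in finitely many steps of length `≤ δ`). [folklore] -/
theorem chain_Icc {Q : ℝ → Prop} {s t δ : ℝ} (hδ : 0 < δ) (h0 : Q s)
    (hstep : ∀ x ∈ Icc s t, ∀ y ∈ Icc s t, Q x → |y - x| ≤ δ → Q y) : ∀ x ∈ Icc s t, Q x := by
  intro x hx
  obtain ⟨n, hn⟩ : ∃ n : ℕ, (x - s) / δ ≤ n := exists_nat_ge _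
  set N : ℕ := n + 1 with hN_def
  have hN : (0 : ℝ) < N := by rw [hN_def]; positivity
  have hxs : 0 ≤ x - s := sub_nonneg.mpr hx.1
  have hsize : (x - s) / N ≤ δ := by
    rw [div_le_iff₀ hN]
    have h1 : (x - s) / δ ≤ (N : ℝ) := hn.trans (by rw [hN_def]; push_cast; linarith)
    rw [div_le_iff₀ hδ] at h1
    linarith [h1]
  let p : ℕ → ℝ := fun k => s + k * ((x - s) / N)
  have hp_mem : ∀ k : ℕ, k ≤ N → p k ∈ Icc s t := by
    intro k hk
    have hk' : (k : ℝ) ≤ N := by exact_mod_cast hk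
    have h0k : 0 ≤ (k : ℝ) * ((x - s) / N) := mul_nonneg (Nat.cast_nonneg k) (div_nonneg hxs hN.le)
    have h1k : (k : ℝ) * ((x - s) / N) ≤ x - s := by
      calc (k : ℝ) * ((x - s) / N) ≤ N * ((x - s) / N) := mul_le_mul_of_nonneg_right hk' (div_nonneg hxs hN.le)
        _ = x - s := by field_simp
    exact ⟨by simp only [p]; linarith, by simp only [p]; linarith [hx.2]⟩
  have main : ∀ k : ℕ, k ≤ N → Q (p k) := by
    intro k
    induction k with
    | zero => intro _; simpa [p] using h0
    | succ k ih =>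
      intro hk
      have hk0 : k ≤ N := Nat.le_of_succ_le hk
      refine hstep (p k) (hp_mem k hk0) (p (k + 1)) (hp_mem _ hk) (ih hk0) ?_
      have e : p (k + 1) - p k = (x - s) / N := by simp only [p]; push_cast; ring
      rw [e, abs_of_nonneg (div_nonneg hxs hN.le)]
      exact hsize
  have e : p N = x := by simp only [p]; field_simp; ring
  simpa [e] using main N le_rfl

/-- `2πiℤ` RIGIDITY: `exp z = 1` and `|Im z| < 2π` force `z = 0`. [folklore] -/
theorem eq_zero_of_exp_eq_one_of_abs_im_lt {z : ℂ} (hz : exp z = 1) (him : |z.im| < 2 * π) : z = 0 := by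
  obtain ⟨n, rfl⟩ := exp_eq_one_iff.1 hz
  have him' : |(n : ℝ)| * (2 * π) < 1 * (2 * π) := by
    have e : ((n : ℂ) * (2 * π * I)).im = n * (2 * π) := by simp
    rw [e, abs_mul, abs_of_pos Real.two_pi_pos] at him
    linarith
  have hn : |(n : ℝ)| < 1 := lt_of_mul_lt_mul_right him' Real.two_pi_pos.le
  have hn0 : n = 0 := by
    rw [← Int.cast_abs] at hn
    have : |n| < 1 := by exact_mod_cast hn
    exact Int.abs_lt_one_iff.mp this
  simp [hn0]

/-- the same with the norm. [folklore] -/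
theorem eq_zero_of_exp_eq_one_of_norm_lt {z : ℂ} (hz : exp z = 1) (hn : ‖z‖ < 2 * π) : z = 0 :=
  eq_zero_of_exp_eq_one_of_abs_im_lt hz (lt_of_le_of_lt (abs_im_le_norm z) hn)

namespace IsContLog

variable {φ ψ : ℝ → ℂ} {s t : ℝ} {L M : ℝ → ℂ}

/-- UNIQUENESS UP TO A CONSTANT: two continuous logarithms of the same function differ by a constant on `[s, t]`
(their difference is continuous with values in the discrete set `2πiℤ`; ε-chain). [folklore] -/
theorem sub_eq_sub (h₁ : IsContLog φ s t L) (h₂ : IsContLog φ s t M) :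
    ∀ x ∈ Icc s t, L x - M x = L s - M s := by
  by_cases hst : s ≤ t
  swap
  · intro x hx; exact absurd (hx.1.trans hx.2) hst
  have hs : s ∈ Icc s t := ⟨le_rfl, hst⟩
  set D : ℝ → ℂ := fun x => L x - M x with hD
  have hDc : ContinuousOn D (Icc s t) := h₁.cont.sub h₂.cont
  have hD1 : ∀ x ∈ Icc s t, exp (D x) = 1 := by
    intro x hx
    rw [hD, exp_sub, h₁.exp_eq x hx, h₂.exp_eq x hx, div_self (h₁.ne_zero hx)]
  obtain ⟨δ, hδ, hδD⟩ := Metric.uniformContinuousOn_iff_le.1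
    (isCompact_Icc.uniformContinuousOn_of_continuous hDc) π Real.pi_pos
  refine chain_Icc (Q := fun x => L x - M x = L s - M s) hδ rfl fun x hx y hy hQ hxy => ?_
  have hclose : dist (D y) (D x) ≤ π := hδD y hy x hx (by rw [Real.dist_eq]; exact hxy)
  have hexp : exp (D y - D x) = 1 := by rw [exp_sub, hD1 y hy, hD1 x hx, div_one]
  have hlt : ‖D y - D x‖ < 2 * π := by
    rw [← dist_eq_norm]; linarith [Real.pi_pos]
  have e := eq_zero_of_exp_eq_one_of_norm_lt hexp hlt
  rw [sub_eq_zero] at e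
  show L y - M y = L s - M s
  rw [← hQ]; exact e

/-- **THE INCREMENT IS WELL DEFINED**: any two continuous logarithms of `φ` on `[s, t]` have the same increment. [folklore] -/
theorem incr_eq (h₁ : IsContLog φ s t L) (h₂ : IsContLog φ s t M) (hst : s ≤ t) : L t - L s = M t - M s := by
  have e := h₁.sub_eq_sub h₂ t ⟨hst, le_rfl⟩
  linear_combination e

/-- ADDITIVITY over consecutive intervals (for one logarithm on the union, trivially). [folklore] -/
theorem incr_add (_h : IsContLog φ s t L) (u : ℝ) : L t - L s = (L u - L s) + (L t - L u) := by ring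

end IsContLog

/-! ### Existence -/

/-- a positive lower bound for a continuous non-vanishing function on a compact interval. [folklore] -/
theorem exists_pos_le_norm {φ : ℝ → ℂ} {s t : ℝ} (hst : s ≤ t) (hφ : ContinuousOn φ (Icc s t))
    (hne : ∀ x ∈ Icc s t, φ x ≠ 0) : ∃ m : ℝ, 0 < m ∧ ∀ x ∈ Icc s t, m ≤ ‖φ x‖ := by
  obtain ⟨x₀, hx₀, hmin⟩ := isCompact_Icc.exists_isMinOn ⟨s, le_rfl, hst⟩ hφ.norm
  exact ⟨‖φ x₀‖, norm_pos_iff.mpr (hne x₀ hx₀), fun x hx => hmin hx⟩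

/-- the quotient of two nearby non-zero numbers lies in the slit plane: `‖w − v‖ < ‖v‖ ⟹ w / v ∈ slitPlane`. [folklore] -/
theorem div_mem_slitPlane_of_norm_sub_lt {v w : ℂ} (h : ‖w - v‖ < ‖v‖) : w / v ∈ slitPlane := by
  have hv : v ≠ 0 := by
    intro hv; rw [hv, sub_zero, norm_zero] at h; exact (norm_nonneg w).not_gt h
  have e : w / v = 1 + (w - v) / v := by field_simp; ring
  rw [e]
  refine mem_slitPlane_of_norm_lt_one ?_
  rw [norm_div, div_lt_one (norm_pos_iff.mpr hv)]
  exact h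

/-- GLUING two continuous logarithms that agree at the junction point. [folklore] -/
theorem IsContLog.glue {φ : ℝ → ℂ} {s u t : ℝ} {L M : ℝ → ℂ} (hL : IsContLog φ s u L) (hM : IsContLog φ u t M)
    (hLM : L u = M u) :
    IsContLog φ s t (fun x => if x ≤ u then L x else M x) where
  cont := by
    refine ContinuousOn.if ?_ ?_ ?_
    · intro x hx
      have hfr : x ∈ frontier {y : ℝ | y ≤ u} := hx.2
      rw [show {y : ℝ | y ≤ u} = Iic u from rfl, frontier_Iic] at hfr
      rw [mem_singleton_iff.mp hfr]; exact hLM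
    · refine hL.cont.mono ?_
      rw [show {y : ℝ | y ≤ u} = Iic u from rfl, closure_Iic]
      exact fun x hx => ⟨hx.1.1, hx.2⟩
    · refine hM.cont.mono ?_
      intro x hx
      have hcl : x ∈ closure (Ioi u) := by
        have e : {y : ℝ | ¬y ≤ u} = Ioi u := by ext y; simp
        rw [← e]; exact hx.2
      rw [closure_Ioi] at hcl
      exact ⟨hcl, hx.1.2⟩
  exp_eq x hx := by
    by_cases hxu : x ≤ u
    · rw [if_pos hxu]; exact hL.exp_eq x ⟨hx.1, hxu⟩
    · rw [if_neg hxu]; exact hM.exp_eq x ⟨(not_le.mp hxu).le, hx.2⟩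

/-- **EXISTENCE**: every continuous non-vanishing `φ` on `[s, t]` has a continuous logarithm (Heine–Cantor gives a step `δ`
on which `φ` moves by less than `min ‖φ‖`; on such a step `L(x_j) + log (φ/φ(x_j))` continues the logarithm; ε-chain). [folklore] -/
theorem exists_isContLog {φ : ℝ → ℂ} {s t : ℝ} (hφ : ContinuousOn φ (Icc s t)) (hne : ∀ x ∈ Icc s t, φ x ≠ 0) :
    ∃ L, IsContLog φ s t L := by
  by_cases hst : s ≤ t
  swap
  · refine ⟨fun _ => 0, ?_, ?_⟩
    · rw [Icc_eq_empty hst]; exact continuousOn_empty _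
    · intro x hx; exact absurd (hx.1.trans hx.2) hst
  obtain ⟨m, hm, hmφ⟩ := exists_pos_le_norm hst hφ hne
  obtain ⟨δ, hδ, hδφ⟩ := Metric.uniformContinuousOn_iff.1
    (isCompact_Icc.uniformContinuousOn_of_continuous hφ) m hm
  have hδ2 : 0 < δ / 2 := by positivity
  refine chain_Icc (Q := fun x => ∃ L, IsContLog φ s x L) hδ2 ?_ ?_ t ⟨hst, le_rfl⟩
  · exact ⟨fun _ => log (φ s), continuousOn_const, fun x hx => by
      rw [show x = s from le_antisymm hx.2 hx.1]; exact exp_log (hne s ⟨le_rfl, hst⟩)⟩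
  · rintro x hx y hy ⟨L, hL⟩ hxy
    by_cases hyx : y ≤ x
    · exact ⟨L, hL.mono le_rfl hyx⟩
    have hxy' : x ≤ y := (not_le.mp hyx).le
    -- the continuation on `[x, y]`
    have hsub : Icc x y ⊆ Icc s t := Icc_subset_Icc hx.1 hy.2
    have hnear : ∀ u ∈ Icc x y, ‖φ u - φ x‖ < ‖φ x‖ := by
      intro u hu
      have hd : dist u x < δ := by
        rw [Real.dist_eq]
        have : |u - x| ≤ |y - x| := by
          rw [abs_of_nonneg (sub_nonneg.mpr hu.1), abs_of_nonneg (sub_nonneg.mpr hxy')]; linarith [hu.2]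
        linarith
      have h1 : dist (φ u) (φ x) < m := hδφ u (hsub hu) x hx hd
      rw [dist_eq_norm] at h1
      exact lt_of_lt_of_le h1 (hmφ x hx)
    have hM : IsContLog φ x y (fun u => L x + log (φ u / φ x)) := by
      refine ⟨continuousOn_const.add ((ContinuousOn.div (hφ.mono hsub) continuousOn_const
        fun _ _ => hne x hx).clog fun u hu => div_mem_slitPlane_of_norm_sub_lt (hnear u hu)), fun u hu => ?_⟩
      rw [exp_add, hL.exp_eq x ⟨hx.1, le_rfl⟩, exp_log (div_ne_zero (hne u (hsub hu)) (hne x hx))]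
      field_simp [hne x hx]
    refine ⟨_, hL.glue hM ?_⟩
    simp [div_self (hne x hx)]

/-! ## §2 The ratio lemma (Rouché on a line) and periodic windows -/

namespace IsContLog

variable {φ ψ : ℝ → ℂ} {s t : ℝ} {L M : ℝ → ℂ}

/-- **THE RATIO LEMMA**: if `ψ` stays closer to `φ` than `‖φ‖` along `[s, t]`, then `L + log (ψ/φ)` is a continuous logarithm
of `ψ` (the quotient `ψ/φ` lives in the disc `|w − 1| < 1`, inside the slit plane). [folklore] -/
theorem of_near (h : IsContLog φ s t L) (hψ : ContinuousOn ψ (Icc s t)) (hnear : ∀ x ∈ Icc s t, ‖ψ x - φ x‖ < ‖φ x‖) :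
    IsContLog ψ s t (fun x => L x + log (ψ x / φ x)) where
  cont := h.cont.add ((hψ.div h.continuousOn fun _ hx => h.ne_zero hx).clog
    fun x hx => div_mem_slitPlane_of_norm_sub_lt (hnear x hx))
  exp_eq x hx := by
    have hψ0 : ψ x ≠ 0 := by
      intro h0
      have := hnear x hx
      rw [h0, zero_sub, norm_neg] at this
      exact lt_irrefl _ this
    rw [exp_add, h.exp_eq x hx, exp_log (div_ne_zero hψ0 (h.ne_zero hx))]
    field_simp [h.ne_zero hx]

/-- **EQUAL INCREMENTS UNDER A SMALL PERTURBATION**: in the situation of the ratio lemma, if `ψ/φ` has the same value at both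
ends (e.g. both functions periodic), every continuous logarithm of `ψ` has the same increment as `L`. [folklore] -/
theorem incr_eq_of_near (h : IsContLog φ s t L) (hψ : ContinuousOn ψ (Icc s t))
    (hnear : ∀ x ∈ Icc s t, ‖ψ x - φ x‖ < ‖φ x‖) (hM : IsContLog ψ s t M) (hst : s ≤ t)
    (hends : ψ t / φ t = ψ s / φ s) : M t - M s = L t - L s := by
  rw [hM.incr_eq (h.of_near hψ hnear) hst, hends]; ring

/-- the general form: the increment of `ψ` is that of `φ` plus the boundary correction `log (ψ t/φ t) − log (ψ s/φ s)`. [folklore] -/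
theorem incr_eq_of_near' (h : IsContLog φ s t L) (hψ : ContinuousOn ψ (Icc s t))
    (hnear : ∀ x ∈ Icc s t, ‖ψ x - φ x‖ < ‖φ x‖) (hM : IsContLog ψ s t M) (hst : s ≤ t) :
    M t - M s = (L t - L s) + (log (ψ t / φ t) - log (ψ s / φ s)) := by
  rw [hM.incr_eq (h.of_near hψ hnear) hst]; ring

/-- LOCAL RIGIDITY: if `ψ` stays closer to its value at a base point `c ∈ [s, t]` than `‖ψ c‖`, every continuous logarithm
`Λ` of `ψ` satisfies `Λ u − Λ c = log (ψ u / ψ c)` on the interval (the principal branch is forced). [folklore] -/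
theorem sub_eq_log_div (hΛ : IsContLog ψ s t M) {c : ℝ} (hc : c ∈ Icc s t)
    (hnear : ∀ u ∈ Icc s t, ‖ψ u - ψ c‖ < ‖ψ c‖) : ∀ u ∈ Icc s t, M u - M c = log (ψ u / ψ c) := by
  have hconst : IsContLog (fun _ => ψ c) s t (fun _ => M c) :=
    ⟨continuousOn_const, fun _ _ => hΛ.exp_eq c hc⟩
  have hN := hconst.of_near hΛ.continuousOn hnear
  have key := hΛ.sub_eq_sub hN
  have e0 := key c hc
  simp only [div_self (hΛ.ne_zero hc), log_one, add_zero, sub_self] at e0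
  intro u hu
  have eu := key u hu
  rw [← e0, sub_eq_zero] at eu
  rw [eu]; ring

end IsContLog

/-- **PERIODIC WINDOWS**: for a `T`-periodic continuous non-vanishing `φ` on `ℝ`, the increment of a continuous logarithm over a
period window `[s, s + T]` does not depend on `s` (nor on the logarithm). [folklore] -/
theorem incr_eq_of_periodic {φ : ℝ → ℂ} {T : ℝ} (hT : 0 ≤ T) (hφ : Continuous φ) (hne : ∀ x, φ x ≠ 0)
    (hper : ∀ x, φ (x + T) = φ x) {s s' : ℝ} {L M : ℝ → ℂ} (hL : IsContLog φ s (s + T) L)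
    (hM : IsContLog φ s' (s' + T) M) : L (s + T) - L s = M (s' + T) - M s' := by
  -- one logarithm `N` on a window containing both
  set A := min s s' with hA
  set B := max s s' + T with hB
  obtain ⟨N, hN⟩ := exists_isContLog (s := A) (t := B) hφ.continuousOn fun x _ => hne x
  have hAs : A ≤ s := min_le_left _ _
  have hAs' : A ≤ s' := min_le_right _ _
  have hsB : s + T ≤ B := by rw [hB]; linarith [le_max_left s s']
  have hs'B : s' + T ≤ B := by rw [hB]; linarith [le_max_right s s']
  -- `x ↦ N (x + T) − N x` is a continuous logarithm of the constant `1` on `[A, B − T]`, hence constant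
  have hG : IsContLog (fun _ => (1 : ℂ)) A (B - T) (fun x => N (x + T) - N x) := by
    refine ⟨?_, fun x hx => ?_⟩
    · refine ContinuousOn.sub (hN.cont.comp (continuousOn_id.add continuousOn_const) fun x hx => ?_)
        (hN.cont.mono (Icc_subset_Icc le_rfl (by linarith)))
      exact ⟨by linarith [hx.1], by linarith [hx.2]⟩
    · rw [exp_sub, hN.exp_eq (x + T) ⟨by linarith [hx.1], by linarith [hx.2]⟩,
        hN.exp_eq x ⟨hx.1, by linarith [hx.2]⟩, hper, div_self (hne x)]
  have h1 : IsContLog (fun _ => (1 : ℂ)) A (B - T) (fun _ => 0) :=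
    ⟨continuousOn_const, fun _ _ => by simp⟩
  have hconst := hG.sub_eq_sub h1
  have es := hconst s ⟨hAs, by linarith⟩
  have es' := hconst s' ⟨hAs', by linarith⟩
  simp only [sub_zero] at es es'
  rw [hL.incr_eq (hN.mono hAs hsB) (by linarith), hM.incr_eq (hN.mono hAs' hs'B) (by linarith), es, es']

end

end Summit.QuantumFields.BalabanUV.Beta.WindingIncrement
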